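import Summits.Ventures.HSemireg.Pad4TowerXresFamilies
import Summits.Ventures.HSemireg.Pad4TowerFCCoreSigns
import Summits.Ventures.HSemireg.Pad4TowerDiamondMu4

/-!
# Venture HSemireg — PAD-4 on 𝔅(μ₄): LINE 5 SEED (B1) at ◇₈, `G₁ = ⟨Δ⟩ × S₄`, hypothesis bundle `H₁ = {X+, A2I−}` — the K-FREE FORM of the
# attributed instance-level verdict «STATIC ∧ FC-CORE UNSAT» as a TYPED STATEMENT (no proof), its sides as decidable predicates, and the
# PROVED corollary «seed ⇒ no positive (A1)-design with μ ≠ 0 on such a support»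

HONEST FRAMING. Lean index of the computation cell `pub-hsemireg` (S4-PUSH, H2 door PAD-4), typed by the Ventures-side typer
`hodge-lit-semireg-typer-2` (g6; line of record stmt-HodgeConjecture-18881 `Cruxes/BlochSeedDiscOne/Lines/birth.lean` 814a6a70c14e831a,
stub `stub_rung_pad4_seedAt`). WHAT THIS FILE IS: the STATEMENT FILE of bc5-plan g7's LINE 5 SEED TEMPLATE v0.1 (`hodge-bloch-bc5-plan/work/g7/
LINE5-SEEDS-TEMPLATE.md` 35a591490aa3302d) §2 `seedB1_diamond8_G1`, with the hypothesis bundle `StaticH H₁` FIXED by LINE 5 (i) result r1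
(bc5-plan g7, cell INBOX l.32495; kit j305149 `W-CORE-FAM-D8-G1-v19`, gates verbatim, fifth independent `core_only all` UNSAT): **`H₁ = RULE-D
closure + {X+, A2I−}`** (greedy drop-one: FC1, X−, A2I+ NOT needed; X+ NEEDED — without it the FULL 97 660-orbit support is a model; A2I− NEEDED —
without it a 35-orbit floor-hung support with mixed-phase FC unit cells is a model; **cadical on RULE-D + {X+, A2I−}: UNSAT 378 s ⇒ ×2 on the
minimal set**: kissat UNSAT 716 s, cadical UNSAT 378 s on the same CNF, 12 276 320 variables ∕ 50 851 397 clauses), director-hodge g13 R13.60 («any typed LINE 5 statement … in its minimal form RULE-D ∧ X+ ∧ A2I− ∧ FC-CORE ⇒ ⊥ needs exactly these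
predicates»), R13.64 («KEY (S) NOW, in exactly this shape»), bc5-plan g7 NOD l.32516 ((P1) block form as headline; (P2) (B2)∕(B1-odd) sequel after r2∕r3).
STATUS WORDS: `SeedB1Diamond8G1H1` is a TYPED STATEMENT — its evidence is MACHINE ×2 at INSTANCE level (kissat + cadical UNSAT on the
CNF «RULE-D closure ∧ X+ ∧ A2I− ∧ FC-mass ∧ FC-CORE presence» over the ◇₈ `G₁`-orbit variables; earlier V1 = all five families UNSAT ×2, j302131,
l.32378; ×4 across two encoders, l.32409); NO pencil proof exists yet (LINE 5 (iii), bc5-plan: «A2I⁻-closed ⇒ no mixed-phase floor FC orbit» and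
«X⁺-closed (+ RULE D) ⇒ the ceiling cannot host the signed pair», l.32498 (3)); NOT a Literature fact; nothing here is an object or a census row.

THE TWO SIDES, LITERALLY (xres2s.py v19 c7ee80d7dccc0bfd, `build_cnf(with_x=True, with_psi=False, with_core=True)` = variant `core_only`, l.1192).
* HYPOTHESIS `StaticH1 C` := `RuleDMu4Closed C` (the RULE-D closure theory `ctheory`; typed in `Pad4TowerRuleDMu4` — FLAG R-1: its agreement with
  the encoder's kinds∕DNF theory is that file's offline evidence, not a theorem) ∧ `XPlusClosed C` ∧ `A2IMinusClosed C` (`Pad4TowerXresFamilies`,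
  clause for clause, literal cross-check 160∕160). The support: two finite levels IN ◇₈ (`Pad4TowerDiamondMu4.MConfig.InDiamond 8`; pool =
  ALL 4-tuples, `JOB_ALLCLASSES=1`) whose levels are each `G₁`-CLOSED (`JOB_ORBIT=g1`: the variables ARE `G₁`-orbits; `G1Closed` = `PermClosed`
  + `DeltaClosed` of (G)∕(D) on both levels) — also the hypothesis under which class-level and orbit-rep-headed closedness agree (FLAG H-1 there).
* CONCLUSION `¬ FCCoreBlock C`, where **`FCCoreBlock`** is the encoder's FC-CORE PRESENCE BLOCK (l.904–921, `JOB_FCCORE=1`, gs-eng-2 g51 LEMMA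
  FC-CORE v1.1 §1b parity form; selectors `e ∕ o`, signs `se ∕ so`, 33 clauses): EITHER some sign `s ≠ 0` such that EVERY even-weight parity
  pattern carries a present FC occurrence of orbit sign `s` at weights 0, 4 and `−s` at weight 2, OR some `t ≠ 0` such that every odd-weight pattern
  carries one of sign `t` at weight 1 and `−t` at weight 3 — in the kernel's vocabulary exactly the conclusion shape of 919's
  `MConfig.signed_presence_all` (`HasSignedFC κ s`: a lower class of pattern `κ` with `sign cprod = s` or an upper one with `sign cprod = −s`; the
  encoder's `(ρ, ε·s₀)` buckets have `ε = −levelSign` and `s₀ = sign cprod · (−1)^{|ρ|}`, so the RELATIVE signs between weight classes — all that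
  matters under `∃ s` — agree: opposite between weights {0,4} and 2, opposite between weights 1 and 3). The FC-mass clause (`with_fc`) is implied by
  the block. The template's two-pattern menu `SignedCoreMenu` (`HasSignedFC 0 s ∧ HasSignedFC 3 (−s)`, resp. `1 ∕ 7`) implies the block only on
  `G₁`-closed supports (S₄ moves patterns within a weight, Δ complements them, 919 §3 keeps the sign on even weights) — template REMARK (a),
  PROVED here as `fcCoreBlock_iff_menu` ∕ `seedB1_menu_iff` (§4b): the seed in the template's wording is EQUIVALENT to the block form. The
  block is the headline because it is what the CNF says and because the corollary needs no orbit propagation with it.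

CONTENT.
* §1 `MConfig.G1Closed`, `MConfig.StaticH1` (decidable). §2 `MConfig.FCCoreEven C s`, `MConfig.FCCoreOdd C t`, `MConfig.FCCoreBlock C`
  (decidable); PROVED **`MConfig.fcCoreBlock_of_classScreen`**: FC classes axis cells + positive multiplicities + (A1) `ClassScreen (C.wch mN mP)` +
  `μ = wch(eeee) ≠ 0` ⇒ `FCCoreBlock C` (919 `signed_presence_all` + (F) `wch_ebarWord_ne_zero_iff`) — the (H1) half, i.e. WHY «STATIC ⇒ ¬block»
  kills designs. §3 **`SeedB1Diamond8G1H1 : Prop`** (the typed statement) and `SeedB1Diamond8G1Static4` (the same with all four instance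
  families: WEAKER, implied — `seedB1Static4_of_H1`). §4 PROVED COROLLARY **`wch_eWord_eq_zero_of_seedB1`**: granted the seed, every integer
  multiplicity vector positive on a `G₁`-closed `H₁`-static two-level support in ◇₈ whose weighted class tensor passes (A1) has `μ = 0` — the
  K-free form of the booked ◇₈-`G₁` verdict W14d (today machine ×2 only), with `axisCell_of_inDiamond` (in ◇₈ every FC cell is an axis cell).
  §4b ORBIT PROPAGATION (PROVED): `hasSignedFC_perm` (S₄ transport, (J) `kbit_cprod_perm`), `hasSignedFC_delta_even` (Δ transport on even
  weight, 919 `cprod_delta_even`), `fcCoreEven_of_menu`, `fcCoreOdd_of_menu`, `MConfig.SignedCoreMenu`, **`fcCoreBlock_iff_menu`** (menu ⇔ block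
  on `G₁`-closed supports in ◇_h), **`seedB1_menu_iff`** (the template's wording ⇔ `SeedB1Diamond8G1H1`).
  §5 probes (`decide`): the block's halves, the bundle and the universe∕closure predicates compute on `diagFour = {[ℓ_u]⁴}`.

WHAT IS NOT HERE ∕ NOT IN LEAN. No proof of the seed (pencil (iii) pending; the SAT certificates are not kernel objects); no (B2)∕(B1-odd) seed
(H₂ ∕ H_odd = LINE 5 (i) r2∕r3, pending at typing time — a sequel types them); no FC1 (∉ H₁; g5 PREP stays PREP, R13.60); no ◇₁₀, no
`G′ = ⟨Δ²⟩ × S₄` (LINE 4); no claim that the encoder's kills are sound (§22∕§17 pencil, cited in the family files). NOTHING HERE SAYS THAT HC ∕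
HC_CM ∕ HC_AV ∕ W₆ ∕ HC_Kum4Type HOLDS OR FAILS; typed ≠ proved ≠ endorsed. No `instance`, no notation, no Literature fact, 0 `sorry`; axioms standard.

SOURCES (sha16 ∕ bus): bc5-plan g7 LINE5-SEEDS-TEMPLATE.md 35a591490aa3302d §0–§3 (l.32395), LINE 5 (i) r1 l.32495 + reading key
`work/g7/LINE5-FAMCORE-READING-KEY.md`, NOD l.32498; director-hodge g13 R13.43 (2) l.32380, R13.48, R13.60; gs-eng-2 g52 r1 reading l.32496;
xres2s.py v19 c7ee80d7dccc0bfd `build_cnf` l.816–922 (`with_fc` l.857, FC-CORE block l.904–921, `parity_info` l.776), `run_famcore.sh`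
304a09a89a281797; attribution j302131 (l.32378), j303027 (l.32409); `Pad4TowerXresFamilies.lean` dfe53b949d77d3f7 (this typer), `Pad4TowerFCCoreSigns.lean`
(919, gs-eng-2 g52), `Pad4TowerDiamondMu4.lean` 90bb8532ff884815, `Pad4TowerPermWindow.lean` (G), `Pad4TowerDeltaWindow.lean` (D), `Pad4TowerRuleDMu4.lean`. -/

namespace Summit.Ventures.HSemireg.Pad4Tower

open Finset

/-! ## §1 The hypothesis side: `G₁`-closed two-level supports, the static bundle `H₁` -/

/-- both levels of the support are closed under the factor permutations `S₄` and under `Δ` (every charged phase `+1`): the `G₁ = ⟨Δ⟩ × S₄`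
-CLOSED supports = exactly the supports expressible in the encoder's `G₁`-orbit variables (`JOB_ORBIT=g1`). Decidable. -/
abbrev MConfig.G1Closed (C : MConfig) : Prop :=
  PermClosed C.lower ∧ PermClosed C.upper ∧ DeltaClosed C.lower ∧ DeltaClosed C.upper

/-- **`StaticH H₁`** with `H₁ = {X+, A2I−}` (LINE 5 (i) r1): RULE-D closure and the two load-bearing instance families closed. Decidable. -/
abbrev MConfig.StaticH1 (C : MConfig) : Prop := RuleDMu4Closed C ∧ XPlusClosed C ∧ A2IMinusClosed C

/-- the same with ALL FOUR instance families (the static side of V1 minus FC1): a STRONGER hypothesis. Decidable. -/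
abbrev MConfig.StaticFour (C : MConfig) : Prop := RuleDMu4Closed C ∧ XresFourClosed C

/-- the four-family bundle contains `H₁`. -/
theorem MConfig.staticH1_of_staticFour {C : MConfig} (h : C.StaticFour) : C.StaticH1 :=
  ⟨h.1, h.2.2.1, h.2.2.2.1⟩

/-! ## §2 The conclusion side: the encoder's FC-CORE presence block, and why a positive (A1)-design with `μ ≠ 0` satisfies it -/

/-- the EVEN half of the FC-CORE block with sign `s`: present signed FC occurrences of orbit sign `s` at the weight-0∕4 patterns `0000`, `1111` and
`−s` at the six weight-2 patterns (encoder: selector `e`, sign `se`; 919 `signed_presence_all`, even half). Decidable. -/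
abbrev MConfig.FCCoreEven (C : MConfig) (s : ℤ) : Prop :=
  C.HasSignedFC 0 s ∧ C.HasSignedFC 15 s ∧ C.HasSignedFC 3 (-s) ∧ C.HasSignedFC 5 (-s) ∧ C.HasSignedFC 6 (-s) ∧ C.HasSignedFC 9 (-s) ∧
    C.HasSignedFC 10 (-s) ∧ C.HasSignedFC 12 (-s)

/-- the ODD half with sign `t`: orbit sign `t` at the four weight-1 patterns, `−t` at the four weight-3 patterns (selector `o`, sign `so`). -/
abbrev MConfig.FCCoreOdd (C : MConfig) (t : ℤ) : Prop :=
  C.HasSignedFC 1 t ∧ C.HasSignedFC 2 t ∧ C.HasSignedFC 4 t ∧ C.HasSignedFC 8 t ∧ C.HasSignedFC 7 (-t) ∧ C.HasSignedFC 11 (-t) ∧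
    C.HasSignedFC 13 (-t) ∧ C.HasSignedFC 14 (-t)

/-- **THE FC-CORE PRESENCE BLOCK** (xres2s v19 l.904–921, `JOB_FCCORE=1`; clause `e ∨ o` + 16 + 16 sign-selected presence clauses): some non-zero
sign realises the even half, or some non-zero sign realises the odd half. (On a support, `HasSignedFC κ (±1)`; `s = 0` is excluded as in the CNF,
where the sign is a Boolean selector.) Decidable for each fixed `s`; as stated, a finite disjunction over `s, t ∈ {1, −1}` — see
`fcCoreBlock_iff`. -/
def MConfig.FCCoreBlock (C : MConfig) : Prop := (∃ s : ℤ, s ≠ 0 ∧ C.FCCoreEven s) ∨ (∃ t : ℤ, t ≠ 0 ∧ C.FCCoreOdd t)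

/-- the sign of an integer is `1`, `0` or `−1`. -/
theorem int_sign_cases (x : ℤ) : x.sign = 1 ∨ x.sign = 0 ∨ x.sign = -1 := by
  rcases lt_trichotomy x 0 with h | h | h
  · exact Or.inr (Or.inr (Int.sign_eq_neg_one_of_neg h))
  · exact Or.inr (Or.inl (by rw [h]; rfl))
  · exact Or.inl (Int.sign_eq_one_of_pos h)

/-- an orbit sign is `±1`: `HasSignedFC κ s` with `s ≠ 0` forces `s = 1 ∨ s = −1`. -/
theorem MConfig.hasSignedFC_sign {C : MConfig} {κ : Fin 16} {s : ℤ} (h : C.HasSignedFC κ s) (hs : s ≠ 0) : s = 1 ∨ s = -1 := by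
  rcases h with ⟨Z, -, -, -, hZ⟩ | ⟨P, -, -, -, hP⟩
  · have := int_sign_cases Z.cprod; omega
  · have := int_sign_cases P.cprod; omega

/-- the block as a FINITE disjunction (decidable form). -/
theorem MConfig.fcCoreBlock_iff (C : MConfig) :
    C.FCCoreBlock ↔ C.FCCoreEven 1 ∨ C.FCCoreEven (-1) ∨ C.FCCoreOdd 1 ∨ C.FCCoreOdd (-1) := by
  constructor
  · rintro (⟨s, hs, h⟩ | ⟨t, ht, h⟩)
    · rcases C.hasSignedFC_sign h.1 hs with rfl | rfl
      · exact Or.inl h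
      · exact Or.inr (Or.inl h)
    · rcases C.hasSignedFC_sign h.1 ht with rfl | rfl
      · exact Or.inr (Or.inr (Or.inl h))
      · exact Or.inr (Or.inr (Or.inr h))
  · rintro (h | h | h | h)
    · exact Or.inl ⟨1, one_ne_zero, h⟩
    · exact Or.inl ⟨-1, by norm_num, h⟩
    · exact Or.inr ⟨1, one_ne_zero, h⟩
    · exact Or.inr ⟨-1, by norm_num, h⟩

/-- **A POSITIVE (A1)-DESIGN WITH `μ ≠ 0` SATISFIES THE FC-CORE BLOCK** (the (H1) half; 919 `signed_presence_all`): if the fully charged classes of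
`C` are axis cells, the multiplicities are positive on the support, the weighted class tensor passes the class screen and `wch(eeee) ≠ 0`, then
`FCCoreBlock C` — with `s = sign Re wch(ēēēē)` when `Re ≠ 0`, else `t = sign Im wch(ēēēē)`. -/
theorem MConfig.fcCoreBlock_of_classScreen (C : MConfig) (mN mP : MCell → ℤ) (hN : ∀ Z ∈ C.lower, FCc Z → AxisCell Z)
    (hP : ∀ P ∈ C.upper, FCc P → AxisCell P) (hmN : ∀ Z ∈ C.lower, 0 < mN Z) (hmP : ∀ P ∈ C.upper, 0 < mP P)
    (hA : ClassScreen (C.wch mN mP)) (hμ : C.wch mN mP eWord ≠ 0) : C.FCCoreBlock := by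
  have hμ' : C.wch mN mP ebarWord ≠ 0 := (C.wch_ebarWord_ne_zero_iff mN mP).2 hμ
  obtain ⟨heven, hodd⟩ := C.signed_presence_all mN mP hN hP hmN hmP hA
  by_cases hre : (C.wch mN mP ebarWord).re = 0
  · have him : (C.wch mN mP ebarWord).im ≠ 0 := fun him => hμ' (Zsqrtd.ext hre him)
    exact Or.inr ⟨_, fun h0 => him (Int.sign_eq_zero_iff_zero.1 h0), hodd him⟩
  · exact Or.inl ⟨_, fun h0 => hre (Int.sign_eq_zero_iff_zero.1 h0), heven hre⟩

/-! ## §3 The seed statement (B1) — TYPED STATEMENT, machine ×2 at instance level, NO proof -/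

/-- **LINE 5 SEED (B1) at ◇₈, `G₁`, `H₁`** (bc5-plan template §2 with `StaticH H₁`, r1): for every two-level configuration of 𝔅(μ₄) cells inside the
diamond universe ◇₈ whose levels are each `G₁ = ⟨Δ⟩ × S₄`-closed, RULE-D closure together with `X+`-closedness and `A2I−`-closedness excludes the
FC-CORE presence block. EVIDENCE (instance level, not a proof): kit j305149 r1 — kissat UNSAT 716 s on RULE-D + {X+, A2I−} (+ FC-mass + FC-CORE),
cadical UNSAT 378 s on the same CNF (12 276 320 ∕ 50 851 397); the full static game (all five families, V1) UNSAT ×5 across j302131, j303027 (second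
encoder) and j305149's control. A HYPOTHESIS-FORM DEF: NOT asserted as a theorem, no `axiom`, no `sorry`; TYPED STATEMENT ONLY. -/
def SeedB1Diamond8G1H1 : Prop :=
  ∀ C : MConfig, C.InDiamond 8 → C.G1Closed → C.StaticH1 → ¬ C.FCCoreBlock

/-- the same seed under the STRONGER bundle of all four instance families (V1's static side minus FC1) — a WEAKER statement. -/
def SeedB1Diamond8G1Static4 : Prop :=
  ∀ C : MConfig, C.InDiamond 8 → C.G1Closed → C.StaticFour → ¬ C.FCCoreBlock

/-- the four-family seed follows from the `H₁` seed. -/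
theorem seedB1Static4_of_H1 (h : SeedB1Diamond8G1H1) : SeedB1Diamond8G1Static4 :=
  fun C hU hG hS => h C hU hG (MConfig.staticH1_of_staticFour hS)

/-! ## §4 The corollary: granted the seed, no positive (A1)-design with `μ ≠ 0` on such a support (PROVED modulo the seed) -/

/-- in ◇_h every fully charged cell is an AXIS cell (a ◇ letter has `β = 0` or `β` on a coordinate axis). -/
theorem MConfig.axisCell_of_inDiamond {h : ℤ} {C : MConfig} (hC : C.InDiamond h) :
    (∀ Z ∈ C.lower, FCc Z → AxisCell Z) ∧ (∀ P ∈ C.upper, FCc P → AxisCell P) := by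
  refine ⟨fun Z hZ hfc f => ?_, fun P hPu hfc f => ?_⟩
  · exact ((hC.1 Z hZ f).1).resolve_left (hfc f)
  · exact ((hC.2 P hPu f).1).resolve_left (hfc f)

/-- **COROLLARY (the K-free form of the booked ◇₈-`G₁` verdict, GRANTED THE SEED).** If `SeedB1Diamond8G1H1` holds, then on every `G₁`-closed
`H₁`-static two-level support in ◇₈, every integer multiplicity vector positive on the support whose weighted class tensor passes the class screen (A1)
has `μ = wch(eeee) = 0` — i.e. no (A1)-feasible positive design with `μ ≠ 0` lives on such a support. [seed + `fcCoreBlock_of_classScreen`] -/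
theorem wch_eWord_eq_zero_of_seedB1 (hseed : SeedB1Diamond8G1H1) (C : MConfig) (hU : C.InDiamond 8) (hG : C.G1Closed)
    (hS : C.StaticH1) (mN mP : MCell → ℤ) (hmN : ∀ Z ∈ C.lower, 0 < mN Z) (hmP : ∀ P ∈ C.upper, 0 < mP P)
    (hA : ClassScreen (C.wch mN mP)) : C.wch mN mP eWord = 0 := by
  by_contra hμ
  obtain ⟨hN, hP⟩ := MConfig.axisCell_of_inDiamond hU
  exact hseed C hU hG hS (C.fcCoreBlock_of_classScreen mN mP hN hP hmN hmP hA hμ)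

/-- the same corollary from the four-family seed under the four-family bundle. -/
theorem wch_eWord_eq_zero_of_seedB1Static4 (hseed : SeedB1Diamond8G1Static4) (C : MConfig) (hU : C.InDiamond 8) (hG : C.G1Closed)
    (hS : C.StaticFour) (mN mP : MCell → ℤ) (hmN : ∀ Z ∈ C.lower, 0 < mN Z) (hmP : ∀ P ∈ C.upper, 0 < mP P)
    (hA : ClassScreen (C.wch mN mP)) : C.wch mN mP eWord = 0 := by
  by_contra hμ
  obtain ⟨hN, hP⟩ := MConfig.axisCell_of_inDiamond hU
  exact hseed C hU hG hS (C.fcCoreBlock_of_classScreen mN mP hN hP hmN hmP hA hμ)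

/-! ## §4b Orbit propagation: on a `G₁`-closed support the template's two-pattern MENU implies the whole block (REMARK (a)) -/

/-- a parity pattern is determined by its four bits. [`decide`] -/
theorem pat_eq_of_bitOf : ∀ κ κ' : Fin 16,
    bitOf κ 0 = bitOf κ' 0 → bitOf κ 1 = bitOf κ' 1 → bitOf κ 2 = bitOf κ' 2 → bitOf κ 3 = bitOf κ' 3 → κ = κ' := by
  decide

/-- the pattern of a permuted cell: if `bitOf κ (σ f) = bitOf κ′ f` for all `f` and `Z.pat = κ`, then `(Z.perm σ).pat = κ′`. -/
theorem MCell.pat_perm_of_bits (Z : MCell) (σ : Equiv.Perm (Fin 4)) {κ κ' : Fin 16} (hZ : Z.pat = κ)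
    (h : ∀ f, bitOf κ (σ f) = bitOf κ' f) : (Z.perm σ).pat = κ' := by
  have hb := (Z.kbit_cprod_perm σ).1
  apply pat_eq_of_bitOf <;> rw [hb, hZ, h]

/-- a fully charged cell stays fully charged under a factor permutation … -/
theorem MCell.fcc_perm {Z : MCell} (hZ : FCc Z) (σ : Equiv.Perm (Fin 4)) : FCc (Z.perm σ) := fun f => hZ (σ f)

/-- … and under `Δ` (`β ↦ iβ` is non-zero iff `β` is). -/
theorem MCell.fcc_delta {Z : MCell} (hZ : FCc Z) : FCc Z.delta := fun f h => by
  have h1 : -(Z f).2.2 = 0 := congrArg Prod.fst h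
  have h2 : (Z f).2.1 = 0 := congrArg Prod.snd h
  exact hZ f (Prod.ext h2 (by simpa using h1))

/-- **TRANSPORT OF A SIGNED OCCURRENCE ALONG `S₄`**: on a support with both levels permutation-closed, a signed FC occurrence of pattern `κ`
gives one of every pattern `κ′` obtained by permuting the bits, with the SAME orbit sign ((J) `kbit_cprod_perm`: `cprod` is `S₄`-invariant). -/
theorem MConfig.hasSignedFC_perm {C : MConfig} (hl : PermClosed C.lower) (hu : PermClosed C.upper) {κ κ' : Fin 16} {s : ℤ}
    (σ : Equiv.Perm (Fin 4)) (hbits : ∀ f, bitOf κ (σ f) = bitOf κ' f) (h : C.HasSignedFC κ s) : C.HasSignedFC κ' s := by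
  rcases h with ⟨Z, hZ, hfc, hp, hc⟩ | ⟨P, hP, hfc, hp, hc⟩
  · exact Or.inl ⟨Z.perm σ, hl σ Z hZ, MCell.fcc_perm hfc σ, Z.pat_perm_of_bits σ hp hbits, by rw [(Z.kbit_cprod_perm σ).2, hc]⟩
  · exact Or.inr ⟨P.perm σ, hu σ P hP, MCell.fcc_perm hfc σ, P.pat_perm_of_bits σ hp hbits, by rw [(P.kbit_cprod_perm σ).2, hc]⟩

/-- **TRANSPORT ALONG `Δ` ON EVEN WEIGHT**: on a support with both levels Δ-closed whose FC cells are axis cells, a signed occurrence of an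
EVEN-weight pattern `κ` gives one of the complementary pattern with the SAME orbit sign (919 §3 `cprod_delta_even`). -/
theorem MConfig.hasSignedFC_delta_even {C : MConfig} (hl : DeltaClosed C.lower) (hu : DeltaClosed C.upper)
    (hN : ∀ Z ∈ C.lower, FCc Z → AxisCell Z) (hP : ∀ P ∈ C.upper, FCc P → AxisCell P) {κ κ' : Fin 16} {s : ℤ}
    (heven : pwt κ % 2 = 0) (hbits : ∀ f, bitOf κ' f = 1 - bitOf κ f) (h : C.HasSignedFC κ s) : C.HasSignedFC κ' s := by
  rcases h with ⟨Z, hZ, hfc, hp, hc⟩ | ⟨P, hPu, hfc, hp, hc⟩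
  · have hax := hN Z hZ hfc
    refine Or.inl ⟨Z.delta, hl Z hZ, MCell.fcc_delta hfc, ?_, ?_⟩
    · apply pat_eq_of_bitOf <;> rw [Z.bitOf_pat_delta hax, hp, hbits]
    · rw [Z.cprod_delta_even hax (by rw [hp]; exact heven), hc]
  · have hax := hP P hPu hfc
    refine Or.inr ⟨P.delta, hu P hPu, MCell.fcc_delta hfc, ?_, ?_⟩
    · apply pat_eq_of_bitOf <;> rw [P.bitOf_pat_delta hax, hp, hbits]
    · rw [P.cprod_delta_even hax (by rw [hp]; exact heven), hc]

/-- **THE EVEN MENU GIVES THE EVEN HALF OF THE BLOCK** on a `G₁`-closed support (FC cells axis cells): `0000` with sign `s` and `0011` with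
`−s` propagate to `1111` (Δ) and to the six weight-2 patterns (factor swaps). -/
theorem MConfig.fcCoreEven_of_menu {C : MConfig} (hG : C.G1Closed) (hN : ∀ Z ∈ C.lower, FCc Z → AxisCell Z)
    (hP : ∀ P ∈ C.upper, FCc P → AxisCell P) {s : ℤ} (h0 : C.HasSignedFC 0 s) (h3 : C.HasSignedFC 3 (-s)) : C.FCCoreEven s := by
  obtain ⟨hpl, hpu, hdl, hdu⟩ := hG
  refine ⟨h0, ?_, h3, ?_, ?_, ?_, ?_, ?_⟩
  · exact MConfig.hasSignedFC_delta_even hdl hdu hN hP (κ := 0) (by decide) (by decide) h0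
  · exact MConfig.hasSignedFC_perm hpl hpu (Equiv.swap 1 2) (by decide) h3
  · exact MConfig.hasSignedFC_perm hpl hpu (Equiv.swap 1 3) (by decide) h3
  · exact MConfig.hasSignedFC_perm hpl hpu (Equiv.swap 0 2) (by decide) h3
  · exact MConfig.hasSignedFC_perm hpl hpu (Equiv.swap 0 3) (by decide) h3
  · exact MConfig.hasSignedFC_perm hpl hpu (Equiv.swap 0 2 * Equiv.swap 1 3) (by decide) h3

/-- **THE ODD MENU GIVES THE ODD HALF**: `0001` with `t` and `0111` with `−t` propagate by factor swaps (no Δ needed). -/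
theorem MConfig.fcCoreOdd_of_menu {C : MConfig} (hG : C.G1Closed) {t : ℤ} (h1 : C.HasSignedFC 1 t) (h7 : C.HasSignedFC 7 (-t)) :
    C.FCCoreOdd t := by
  obtain ⟨hpl, hpu, -, -⟩ := hG
  refine ⟨h1, ?_, ?_, ?_, h7, ?_, ?_, ?_⟩
  · exact MConfig.hasSignedFC_perm hpl hpu (Equiv.swap 2 3) (by decide) h1
  · exact MConfig.hasSignedFC_perm hpl hpu (Equiv.swap 1 3) (by decide) h1
  · exact MConfig.hasSignedFC_perm hpl hpu (Equiv.swap 0 3) (by decide) h1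
  · exact MConfig.hasSignedFC_perm hpl hpu (Equiv.swap 0 1) (by decide) h7
  · exact MConfig.hasSignedFC_perm hpl hpu (Equiv.swap 0 2) (by decide) h7
  · exact MConfig.hasSignedFC_perm hpl hpu (Equiv.swap 0 3) (by decide) h7

/-- the template's TWO-PATTERN MENU (bc5-plan LINE5-SEEDS-TEMPLATE §2, the conclusion of `seedB1_diamond8_G1` negated; 919's headline
`signed_fcCore_of_classScreen` disjuncts with the sign free). -/
def MConfig.SignedCoreMenu (C : MConfig) : Prop :=
  (∃ s : ℤ, s ≠ 0 ∧ C.HasSignedFC 0 s ∧ C.HasSignedFC 3 (-s)) ∨ (∃ t : ℤ, t ≠ 0 ∧ C.HasSignedFC 1 t ∧ C.HasSignedFC 7 (-t))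

/-- **MENU ⇔ BLOCK on `G₁`-closed supports in ◇_h** (REMARK (a) of the template): the block trivially contains the menu; conversely the menu
propagates to the block by `S₄` and `Δ`. -/
theorem MConfig.fcCoreBlock_iff_menu {C : MConfig} {h : ℤ} (hU : C.InDiamond h) (hG : C.G1Closed) :
    C.FCCoreBlock ↔ C.SignedCoreMenu := by
  obtain ⟨hN, hP⟩ := MConfig.axisCell_of_inDiamond hU
  constructor
  · rintro (⟨s, hs, h⟩ | ⟨t, ht, h⟩)
    · exact Or.inl ⟨s, hs, h.1, h.2.2.1⟩
    · exact Or.inr ⟨t, ht, h.1, h.2.2.2.2.1⟩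
  · rintro (⟨s, hs, h0, h3⟩ | ⟨t, ht, h1, h7⟩)
    · exact Or.inl ⟨s, hs, C.fcCoreEven_of_menu hG hN hP h0 h3⟩
    · exact Or.inr ⟨t, ht, C.fcCoreOdd_of_menu hG h1 h7⟩

/-- hence the seed in the TEMPLATE's wording (menu form) is EQUIVALENT to `SeedB1Diamond8G1H1`. -/
theorem seedB1_menu_iff :
    SeedB1Diamond8G1H1 ↔ ∀ C : MConfig, C.InDiamond 8 → C.G1Closed → C.StaticH1 → ¬ C.SignedCoreMenu := by
  constructor
  · intro hs C hU hG hS hm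
    exact hs C hU hG hS ((MConfig.fcCoreBlock_iff_menu hU hG).2 hm)
  · intro hs C hU hG hS hb
    exact hs C hU hG hS ((MConfig.fcCoreBlock_iff_menu hU hG).1 hb)

/-! ## §5 Probes (`decide`; the predicates compute) -/

section Probes

/-- the one-orbit probe support of 919 §4: the `S₄ × Δ`-orbit of `[ℓ₁|ℓ₁|ℓ₁|ℓ₁]` is `{[ℓ_u]⁴ : u}` (4 cells); put them at level `N`. -/
def diagFour : MConfig := ⟨{mcellOf (lpt 1 0) (lpt 1 0) (lpt 1 0) (lpt 1 0), mcellOf (lpt 1 1) (lpt 1 1) (lpt 1 1) (lpt 1 1),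
  mcellOf (lpt 1 2) (lpt 1 2) (lpt 1 2) (lpt 1 2), mcellOf (lpt 1 3) (lpt 1 3) (lpt 1 3) (lpt 1 3)}, ∅⟩

set_option synthInstance.maxSize 8192 in
set_option synthInstance.maxHeartbeats 2000000 in -- large decidable instances, as in the family files
/-- `diagFour` lies in ◇₈ and is `G₁`-closed, and RULE D fails at its floor unit cell `[ℓ₁]⁴` (nothing below it), so it is NOT
`H₁`-static. [kernel, `decide`] -/
theorem diagFour_probe : diagFour.InDiamond 8 ∧ diagFour.G1Closed ∧
    ¬ RuleDMu4N diagFour (mcellOf (lpt 1 0) (lpt 1 0) (lpt 1 0) (lpt 1 0)) := by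
  refine ⟨?_, ?_, ?_⟩ <;> decide +kernel

/-- hence `diagFour` is not `H₁`-static. -/
theorem diagFour_not_staticH1 : ¬ diagFour.StaticH1 := fun h =>
  diagFour_probe.2.2 (h.1.1 _ (by decide +kernel))

set_option synthInstance.maxSize 8192 in
set_option synthInstance.maxHeartbeats 2000000 in -- as above
/-- `diagFour` carries signed FC occurrences at the patterns `0000` and `1111` only, so both halves of the FC-CORE block FAIL there for both signs
(no weight-2 pattern, no odd pattern). [kernel, `decide` after unfolding `HasSignedFC`] -/
theorem diagFour_halves : ¬ diagFour.FCCoreEven 1 ∧ ¬ diagFour.FCCoreEven (-1) ∧ ¬ diagFour.FCCoreOdd 1 ∧ ¬ diagFour.FCCoreOdd (-1) := by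
  unfold MConfig.FCCoreEven MConfig.FCCoreOdd MConfig.HasSignedFC
  refine ⟨?_, ?_, ?_, ?_⟩ <;> decide +kernel

/-- hence the block fails on `diagFour` (through `fcCoreBlock_iff`): the seed's conclusion holds there trivially, its hypothesis does not. -/
theorem diagFour_not_block : ¬ diagFour.FCCoreBlock := fun h => by
  obtain ⟨h1, h2, h3, h4⟩ := diagFour_halves
  rcases (diagFour.fcCoreBlock_iff).1 h with h | h | h | h
  · exact h1 h
  · exact h2 h
  · exact h3 h
  · exact h4 h

end Probes

end Summit.Ventures.HSemireg.Pad4Tower
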